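import Mathlib.AlgebraicGeometry.Morphisms.UniversallyClosed
import Mathlib.AlgebraicGeometry.Morphisms.OpenImmersion
import HarnessLib

/-!
# Quasi-compact open neighbourhoods in schemes; surjective open immersions

Topic: `Literature/AlgebraicGeometry/Morphisms`. Two pieces of point-set bookkeeping from the
Stacks Project's proof of Nagata's compactification theorem (Tag 0F41), PROVED over Mathlib:

* `exists_isCompact_isOpen_superset` — a quasi-compact subset `K` of an open `O` of a scheme has
  a quasi-compact open neighbourhood inside `O` (a scheme has a basis of quasi-compact opens: the
  affine ones); `exists_isCompact_isOpen_separating` — hence two disjoint closed subsets of a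
  quasi-compact scheme are separated by a quasi-compact open containing the first. This is the
  step "Since `V` is a spectral topological space, we can find constructible closed subsets
  `T_c, T'_c` with `T ⊂ T_c`, `T' ⊂ T'_c` such that `T_c ∩ T'_c = ∅` (choose a quasi-compact open
  `W` of `V` containing `T'` not meeting `T` and set `T_c = V ∖ W`, …)" of Tag 0F3W.
* `isIso_of_isOpenImmersion_of_dense_subset_range` — an open immersion with closed image
  containing a dense subset is an isomorphism (used in Tag 0F3W to upgrade "the strict transform
  is an open subscheme" (Tag 081S) to "the strict transform maps isomorphically to `Y₀'`" for a
  proper morphism).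

## References

* The Stacks Project, Tag 0F3W (More on Flatness, Lemma 38.33.3), proof. [StacksProject]
-/

noncomputable section

universe u

open CategoryTheory AlgebraicGeometry TopologicalSpace

namespace Literature.AlgebraicGeometry.Morphisms

variable {X Y : Scheme.{u}}

/-- **A quasi-compact subset of an open of a scheme has a quasi-compact open neighbourhood
inside that open** (schemes have a basis of quasi-compact — affine — opens). [folklore] -/
theorem exists_isCompact_isOpen_superset {K O : Set X} (hK : IsCompact K) (hO : IsOpen O)
    (hKO : K ⊆ O) : ∃ W : X.Opens, IsCompact (W : Set X) ∧ K ⊆ W ∧ (W : Set X) ⊆ O := by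
  classical
  -- affine opens `U_x ∋ x` inside `O`
  have hU : ∀ x : K, ∃ U : X.Opens, IsAffineOpen U ∧ (x : X) ∈ U ∧ (U : Set X) ⊆ O := by
    intro x
    obtain ⟨U, hU, hxU, hUO⟩ := exists_isAffineOpen_mem_and_subset (X := X) (x := (x : X))
      (U := ⟨O, hO⟩) (hKO x.2)
    exact ⟨U, hU, hxU, hUO⟩
  choose U hUa hxU hUO using hU
  obtain ⟨t, ht⟩ := hK.elim_finite_subcover (fun x : K => ((U x : X.Opens) : Set X))
    (fun x => (U x).2) (fun y hy => Set.mem_iUnion.mpr ⟨⟨y, hy⟩, hxU ⟨y, hy⟩⟩)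
  refine ⟨⨆ x : {x // x ∈ t}, U x.1, ?_, fun y hy => ?_, ?_⟩
  · rw [Opens.coe_iSup]
    exact isCompact_iUnion fun x => (hUa x.1).isCompact
  · obtain ⟨x, hx, hyx⟩ := Set.mem_iUnion₂.mp (ht hy)
    exact Opens.mem_iSup.mpr ⟨⟨x, hx⟩, hyx⟩
  · rw [Opens.coe_iSup]
    exact Set.iUnion_subset fun x => hUO x.1

/-- **Separating disjoint closed subsets of a quasi-compact scheme by a quasi-compact open**: for
`Z₁, Z₂ ⊆ X` closed and disjoint, `X` quasi-compact, there is a quasi-compact open `W ⊇ Z₁`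
disjoint from `Z₂`. [cite: StacksProject, Tag 0F3W (proof)] -/
theorem exists_isCompact_isOpen_separating [CompactSpace X] {Z₁ Z₂ : Set X} (hZ₁ : IsClosed Z₁)
    (hZ₂ : IsClosed Z₂) (h : Disjoint Z₁ Z₂) :
    ∃ W : X.Opens, IsCompact (W : Set X) ∧ Z₁ ⊆ W ∧ Disjoint (W : Set X) Z₂ := by
  obtain ⟨W, hWc, hZW, hWO⟩ := exists_isCompact_isOpen_superset hZ₁.isCompact hZ₂.isOpen_compl
    h.subset_compl_right
  exact ⟨W, hWc, hZW, Set.disjoint_left.mpr fun x hx hx₂ => hWO hx hx₂⟩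

/-- **An open immersion with closed image containing a dense subset is an isomorphism.**
[folklore] -/
theorem isIso_of_isOpenImmersion_of_dense_subset_range (f : X ⟶ Y) [IsOpenImmersion f]
    (hcl : IsClosed (Set.range f)) {D : Set Y} (hD : Dense D) (hDf : D ⊆ Set.range f) :
    IsIso f := by
  have hsurj : Function.Surjective f := by
    rw [← Set.range_eq_univ, ← Set.univ_subset_iff, ← (hD.mono hDf).closure_eq]
    exact hcl.closure_subset
  haveI : Epi f.base := (TopCat.epi_iff_surjective f.base).mpr hsurj
  exact (isIso_iff_isOpenImmersion_and_epi_base f).mpr ⟨inferInstance, inferInstance⟩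

/-- In particular **a universally closed open immersion whose image contains a dense subset is an
isomorphism** (Tag 0F3W: the strict transform of a proper morphism, once an open subscheme of the
blown-up base containing the dense complement of the exceptional divisor, is all of it).
[cite: StacksProject, Tag 0F3W (proof)] -/
theorem isIso_of_isOpenImmersion_of_universallyClosed_of_dense (f : X ⟶ Y) [IsOpenImmersion f]
    [UniversallyClosed f] {D : Set Y} (hD : Dense D) (hDf : D ⊆ Set.range f) : IsIso f :=
  isIso_of_isOpenImmersion_of_dense_subset_range f f.isClosedMap.isClosed_range hD hDf

end Literature.AlgebraicGeometry.Morphisms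

end
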